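import Summits.SmoothPoincare4.SmoothPoincare4.Theses.WeylBudget
import Literature.Geometry.Riemannian.ChangGurskyYangProofs
import HarnessLib

/-!
# Stub B1 `stub_symmetricWeylLightMetric` of the crux `CorkRegluingBudget`: the round-equivariant case

Crux `Summit.SmoothPoincare4.SmoothPoincare4.Theses.WeylBudget.CorkRegluingBudget` (item
stmt-SmoothPoincare4-10831, route WeylBudget, line `registered` = `Lines/birth.lean`), Stub B1
(load-bearing, held by the lead).  Stub B1 asks, for every involutive cork splitting
`S⁴ = C ∪_φ W` of the standard sphere, for a presentation `jC, jW`, a Riemannian metric `g` on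
`S⁴` with Levi-Civita connection, `scal_g > 0` and Weyl energy `< 32π²`, an open `U ⊇ seam` and a
map `Φ`, smooth and injective on `U`, `g`-isometric on `U`, side-preserving and restricting to the
cork involution `τ` on the seam.  Everything here is proved; no definitions, no named facts.

* `symmetricWeylLightMetric_of_roundEquivariant` — **the equivariant case of B1**: if the given
  presentation `jC, jW` admits a GLOBAL smooth injective isometry `Ψ` of the ROUND metric which
  preserves the two pieces and restricts to `τ` on the seam, then the conclusion of B1 holds with
  `g` the round metric (`R = 12 > 0`, `∫|W|² = 0 < 32π²`: tree theorems
  `scalarCurvature_roundMetric_pos`, `weylEnergy_roundMetric_eq_zero`), `U = univ`, `Φ = Ψ`.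
  This is the case in which the cork twist is undone by a symmetry of the round sphere (e.g. a
  linear involution of `S⁴` preserving a symmetric cork); it certifies that the fourteen
  conjuncts of B1's conclusion are jointly satisfiable as typed.
* `symmetricWeylLightMetric_of_refl` — **B1 for the trivial twist `τ = id`**: for every boundary
  gluing `S⁴ = C ∪_φ W` the conclusion of B1 with `τ z` replaced by `z` holds (`Ψ = id`).

What remains of B1 after this file is exactly its non-equivariant content: a τ-symmetric
PSC Weyl-light germ along the boundary of a cork whose involution does NOT extend to a round
isometry (open-problem grade; see the line's census).

References: S.-Y. A. Chang, M. Gursky, P. Yang, *A conformally invariant sphere theorem in four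
dimensions*, Publ. IHÉS 98 (2003), Thm. A [ChangGurskyYang2003]; B. O'Neill, *Semi-Riemannian
Geometry* (1983), Ch. 3, Def. 3.4 [ONeill1983]; J. M. Lee, *Introduction to Riemannian
Manifolds* (2018), Prop. 8.36 [Lee2018].
-/

-- the prescribed namespace `Summit.<P>.<Sub>.…` duplicates `SmoothPoincare4` (P = Sub)
set_option linter.dupNamespace false

open scoped Manifold ContDiff Topology
-- Mathlib's scoped instance `Fact (finrank ℝ (EuclideanSpace ℝ (Fin n)) = n)`, feeding the
-- `[Fact (finrank ℝ V = 4 + 1)]` hypothesis of `roundMetric (n := 4) (EuclideanSpace ℝ (Fin 5))`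
open scoped EuclideanSpace
open Set Function

noncomputable section

namespace Summit.SmoothPoincare4.SmoothPoincare4.Theorems.CorkRegluingBudget

open Literature.Geometry.Lorentzian Literature.Geometry.Lorentzian.PseudoRiemannianMetric
  Literature.Geometry.Riemannian Literature.Topology.FourManifolds

/-- **Stub B1 in the round-equivariant case.**  Let `S⁴ = C ∪_φ W` be presented by smooth
embeddings `jC, jW` (covering, seam relation `jC (ι z) = jW (ι (φ z))`) and let `Ψ : S⁴ → S⁴` be
smooth, injective, an isometry of the ROUND metric (`Ψ^* g_round = g_round`), mapping `jC C` into
`jC C` and `jW W` into `jW W`, and restricting to `τ` on the seam, `Ψ (jC (ι z)) = jC (ι (τ z))`.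
Then the conclusion of Stub B1 holds: take `g = g_round` (Levi-Civita connection
`PseudoRiemannianMetric.hasLeviCivita`, `R = 12 > 0` by `scalarCurvature_roundMetric_pos`,
`∫|W|² = 0 < 32π²` by `weylEnergy_roundMetric_eq_zero`), `U = univ` and `Φ = Ψ`.
[cite: ChangGurskyYang2003, Thm. A (round model, p. 106)] [cite: Lee2018, Prop. 8.36] -/
theorem symmetricWeylLightMetric_of_roundEquivariant :
    ∀ (C : Type) [TopologicalSpace C] [ChartedSpace (EuclideanHalfSpace 4) C]
    (bC : Literature.Topology.FourManifolds.BoundaryData (𝓡∂ 4) C (𝓡 3))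
    (W : Type) [TopologicalSpace W] [ChartedSpace (EuclideanHalfSpace 4) W]
    (bW : Literature.Topology.FourManifolds.BoundaryData (𝓡∂ 4) W (𝓡 3))
    (φ : bC.carrier ≃ₘ⟮𝓡 3, 𝓡 3⟯ bW.carrier) (τ : bC.carrier ≃ₘ⟮𝓡 3, 𝓡 3⟯ bC.carrier)
    (jC : C → Metric.sphere (0 : EuclideanSpace ℝ (Fin 5)) 1)
    (jW : W → Metric.sphere (0 : EuclideanSpace ℝ (Fin 5)) 1)
    (Ψ : Metric.sphere (0 : EuclideanSpace ℝ (Fin 5)) 1 → Metric.sphere (0 : EuclideanSpace ℝ (Fin 5)) 1),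
    Manifold.IsSmoothEmbedding (𝓡∂ 4) (𝓡 4) ∞ jC →
    Manifold.IsSmoothEmbedding (𝓡∂ 4) (𝓡 4) ∞ jW →
    Set.range jC ∪ Set.range jW = Set.univ →
    (∀ a b, jC a = jW b ↔ ∃ z, a = bC.incl z ∧ b = bW.incl (φ z)) →
    ContMDiff (𝓡 4) (𝓡 4) ∞ Ψ → Function.Injective Ψ →
    (∀ x, Literature.Geometry.Lorentzian.pullbackBilin (I := 𝓡 4) (I' := 𝓡 4) Ψ
      (Literature.Geometry.Riemannian.roundMetric (n := 4) (EuclideanSpace ℝ (Fin 5))).val x =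
        (Literature.Geometry.Riemannian.roundMetric (n := 4) (EuclideanSpace ℝ (Fin 5))).val x) →
    (∀ x, x ∈ Set.range jC → Ψ x ∈ Set.range jC) →
    (∀ x, x ∈ Set.range jW → Ψ x ∈ Set.range jW) →
    (∀ z, Ψ (jC (bC.incl z)) = jC (bC.incl (τ z))) →
    ∃ (jC : C → Metric.sphere (0 : EuclideanSpace ℝ (Fin 5)) 1)
      (jW : W → Metric.sphere (0 : EuclideanSpace ℝ (Fin 5)) 1)
      (g : Literature.Geometry.Lorentzian.PseudoRiemannianMetric (𝓡 4) ∞ (EuclideanSpace ℝ (Fin 4))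
        (TangentSpace (𝓡 4) : Metric.sphere (0 : EuclideanSpace ℝ (Fin 5)) 1 → Type _))
      (U : Set (Metric.sphere (0 : EuclideanSpace ℝ (Fin 5)) 1))
      (Φ : Metric.sphere (0 : EuclideanSpace ℝ (Fin 5)) 1 → Metric.sphere (0 : EuclideanSpace ℝ (Fin 5)) 1),
      Manifold.IsSmoothEmbedding (𝓡∂ 4) (𝓡 4) ∞ jC ∧
        Manifold.IsSmoothEmbedding (𝓡∂ 4) (𝓡 4) ∞ jW ∧
        Set.range jC ∪ Set.range jW = Set.univ ∧
        (∀ a b, jC a = jW b ↔ ∃ z, a = bC.incl z ∧ b = bW.incl (φ z)) ∧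
        g.IsRiemannian ∧
        (∃ _ : g.HasLeviCivita, (∀ x, 0 < g.scalarCurvature x) ∧
            g.weylEnergy < ENNReal.ofReal (32 * Real.pi ^ 2)) ∧
        IsOpen U ∧
        (∀ z, jC (bC.incl z) ∈ U) ∧
        ContMDiffOn (𝓡 4) (𝓡 4) ∞ Φ U ∧
        Set.InjOn Φ U ∧
        (∀ x ∈ U, Literature.Geometry.Lorentzian.pullbackBilin (I := 𝓡 4) (I' := 𝓡 4) Φ g.val x = g.val x) ∧
        (∀ x ∈ U, x ∈ Set.range jC → Φ x ∈ Set.range jC) ∧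
        (∀ x ∈ U, x ∈ Set.range jW → Φ x ∈ Set.range jW) ∧
        (∀ z, Φ (jC (bC.incl z)) = jC (bC.incl (τ z))) := by
  intro C _ _ bC W _ _ bW φ τ jC jW Ψ hjC hjW hcov hseam hΨs hΨi hΨg hΨC hΨW hΨτ
  haveI : (roundMetric (n := 4) (EuclideanSpace ℝ (Fin 5))).HasLeviCivita :=
    (roundMetric (n := 4) (EuclideanSpace ℝ (Fin 5))).hasLeviCivita
  refine ⟨jC, jW, roundMetric (n := 4) (EuclideanSpace ℝ (Fin 5)), Set.univ, Ψ, hjC, hjW, hcov,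
    hseam, isRiemannian_roundMetric, ⟨‹_›, fun x ↦
      scalarCurvature_roundMetric_pos (EuclideanSpace ℝ (Fin 5)) (by norm_num) x, ?_⟩,
    isOpen_univ, fun _ ↦ Set.mem_univ _, hΨs.contMDiffOn, hΨi.injOn, fun x _ ↦ hΨg x,
    fun x _ hx ↦ hΨC x hx, fun x _ hx ↦ hΨW x hx, hΨτ⟩
  rw [weylEnergy_roundMetric_eq_zero (EuclideanSpace ℝ (Fin 5)) (by norm_num)]
  exact ENNReal.ofReal_pos.2 (by positivity)

/-- **Stub B1 for the trivial twist.**  For every boundary gluing `S⁴ = C ∪_φ W` of the standard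
sphere (any presentation, extracted from `IsBoundaryGluing`) the conclusion of Stub B1 with the
twist `τ = id` holds: the round metric with `U = univ` and `Φ = id` (`pullbackBilin_id`).  This is
the case `Σ = S⁴` reglued by the identity. [cite: ChangGurskyYang2003, Thm. A (round model, p. 106)] -/
theorem symmetricWeylLightMetric_of_refl :
    ∀ (C : Type) [TopologicalSpace C] [ChartedSpace (EuclideanHalfSpace 4) C]
    (bC : Literature.Topology.FourManifolds.BoundaryData (𝓡∂ 4) C (𝓡 3))
    (W : Type) [TopologicalSpace W] [ChartedSpace (EuclideanHalfSpace 4) W]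
    (bW : Literature.Topology.FourManifolds.BoundaryData (𝓡∂ 4) W (𝓡 3))
    (φ : bC.carrier ≃ₘ⟮𝓡 3, 𝓡 3⟯ bW.carrier),
    Literature.Topology.FourManifolds.IsBoundaryGluing bC bW φ (𝓡 4)
      (Metric.sphere (0 : EuclideanSpace ℝ (Fin 5)) 1) →
    ∃ (jC : C → Metric.sphere (0 : EuclideanSpace ℝ (Fin 5)) 1)
      (jW : W → Metric.sphere (0 : EuclideanSpace ℝ (Fin 5)) 1)
      (g : Literature.Geometry.Lorentzian.PseudoRiemannianMetric (𝓡 4) ∞ (EuclideanSpace ℝ (Fin 4))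
        (TangentSpace (𝓡 4) : Metric.sphere (0 : EuclideanSpace ℝ (Fin 5)) 1 → Type _))
      (U : Set (Metric.sphere (0 : EuclideanSpace ℝ (Fin 5)) 1))
      (Φ : Metric.sphere (0 : EuclideanSpace ℝ (Fin 5)) 1 → Metric.sphere (0 : EuclideanSpace ℝ (Fin 5)) 1),
      Manifold.IsSmoothEmbedding (𝓡∂ 4) (𝓡 4) ∞ jC ∧
        Manifold.IsSmoothEmbedding (𝓡∂ 4) (𝓡 4) ∞ jW ∧
        Set.range jC ∪ Set.range jW = Set.univ ∧
        (∀ a b, jC a = jW b ↔ ∃ z, a = bC.incl z ∧ b = bW.incl (φ z)) ∧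
        g.IsRiemannian ∧
        (∃ _ : g.HasLeviCivita, (∀ x, 0 < g.scalarCurvature x) ∧
            g.weylEnergy < ENNReal.ofReal (32 * Real.pi ^ 2)) ∧
        IsOpen U ∧
        (∀ z, jC (bC.incl z) ∈ U) ∧
        ContMDiffOn (𝓡 4) (𝓡 4) ∞ Φ U ∧
        Set.InjOn Φ U ∧
        (∀ x ∈ U, Literature.Geometry.Lorentzian.pullbackBilin (I := 𝓡 4) (I' := 𝓡 4) Φ g.val x = g.val x) ∧
        (∀ x ∈ U, x ∈ Set.range jC → Φ x ∈ Set.range jC) ∧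
        (∀ x ∈ U, x ∈ Set.range jW → Φ x ∈ Set.range jW) ∧
        (∀ z, Φ (jC (bC.incl z)) = jC (bC.incl z)) := by
  intro C _ _ bC W _ _ bW φ hS4
  obtain ⟨jC, jW, hjC, hjW, hcov, hseam⟩ := hS4
  obtain ⟨jC', jW', g, U, Φ, h⟩ :=
    symmetricWeylLightMetric_of_roundEquivariant C bC W bW φ (Diffeomorph.refl (𝓡 3) bC.carrier ∞)
      jC jW id hjC hjW hcov hseam contMDiff_id injective_id
      (fun x ↦ by rw [pullbackBilin_id]) (fun _ hx ↦ hx) (fun _ hx ↦ hx) (fun _ ↦ rfl)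
  exact ⟨jC', jW', g, U, Φ, by simpa using h⟩

end Summit.SmoothPoincare4.SmoothPoincare4.Theorems.CorkRegluingBudget

end
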